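import Summits.QuantumFields.BalabanUV.T4Continuum.Support.NE3SlicePoincareSkeleton
import Summits.QuantumFields.BalabanUV.T4Continuum.Support.NE3CombVsTowerEnd
import Summits.QuantumFields.BalabanUV.T4Continuum.Support.NE3FrameFreeTangency
import Summits.QuantumFields.BalabanUV.T4Continuum.Support.NE3ExactLineSumsL2
import Summits.QuantumFields.BalabanUV.T4Continuum.Support.NE3CovariantFacePairings
import Summits.QuantumFields.BalabanUV.T4Continuum.Support.NE3CurvedProjectedLandau
import HarnessLib

/-!
# NE3SlicePoincareRemainderE (T⁴ programme, node NE3, row K6 of the owner's ruling ρ-g22-2, part K6b-3 of the cut ρ-g23-3 §3) — (E): THE NON-EXACT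
# PART `E := ω − D_Uψ` OF THE COMB LINE SUMS OF `η′` IS THREE NAMED SMALL TERMS, ITS WEIGHTED ENERGY `ℰ := M^d·Σ nhsNormSq E`, AND THE `R_E` PAIRING

NE3 (node U1b) formalisation swarm `b2b-balaban-t4-ne3-formalise-*`, leaf seat `b2b-balaban-t4-ne3-formalise-leaf-02` (gen 6), row **K6**
(assembly of the curved (P♮), booked → leaf-02 lineage; blueprint `HOME/t4/b2b-balaban-t4-ne3-p1/g23/D-ne3p1-g23-1.md` = ruling ρ-g23-3 §1 (E), §2(c);
disprover D-ne3r2-g9-1 (4): currency `ℰ := M^d·Σ_{z∈periodBox N}Σ_κ nhsNormSq (E z κ)`, pieces (E1)(E2)(E3)).  Over leaf-04's K4-0 END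
`NE3CombVsTowerEnd.sum_norm_TWc_sub_Ad_QstrIter_sq_le` (E3), their Φ5-TAN `NE3FrameFreeTangency.QstrIter_eq_neg_ErrIter_of_frameFree` + C1
`NE3CovariantLineSumsL2Tower.sqrt_l2sq_ErrIter_le` (E1), their K3 `NE3ExactLineSumsTower.QstrIter_gaugeDir_eq` + `NE3ExactLineSumsL2.l2sq_DefIter_le_of_levelSmall`
(E2), and leaf-03-g8's K6-face (P4) `NE3CovariantFacePairings.abs_sum_hsR_JmpW_le_sqrt` BY NAME.  All [folklore], 0 sorry, 0 def.  With
`M = L^{k+1}`, `U := cavgIter L (k+1) W`, `ψ := bmeanIterW L (k+1) W ζ′`, `ω := ((L^d)⁻¹)^{k+1} • TWc L (k+1) W η′`, `Δ := ω − Ad U (QstrIter L (k+1) W η′)`: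
§1 `Ad_gaugeDir_eq_neg_cD` (`Ad_{U(z,κ)} (gaugeDir U ψ z κ) = −cD U κ ψ z`), **`nonexact_eq`** — for `Y ∈ frameFreeBlockLandauW L N (k+1) W` written
   `Y = η′ + gaugeDir W ζ′`: `ω z κ − cD U κ ψ z = Δ z κ − Ad (U z κ) (ErrIter L (k+1) W Y z κ) − Ad (U z κ) (DefIter L (k+1) W ζ′ z κ)` (exact);
§2 `nhsNormSq_nonexact_le` (`≤ 4‖Δ‖² + 4‖ErrIter‖² + 2‖DefIter‖²` in nhs, unitary transports dropped), and **`weightedEnergy_nonexact_le`**: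
   `ℰ ≤ 4·(2(4d+5)∕10·DSum d L (k+1) x)²·M²·card n·h² + 16·S2sum²·L^d·(L^k)²·card n·y² + 2d(20·loopRad(r_k))²·card n·Σ nhsNormSq ζ′`
   (`h² = ΣΣ nhsNormSq η′`, `y² = ΣΣ nhsNormSq Y` over `periodBox (M·N)`; `M^d·(L²∕L^d)^k = L^d·(L^k)²`; every op-norm `l2sq` of the inputs converted
   by `‖X‖² ≤ card n·nhsNormSq X`);
§3 **`abs_RE_le`** (`d ≥ 1`) — the `R_E` pairing of K4-d2's named remainder: `(M²)⁻¹·|Σ_xΣ_κ hsR (JmpW M W (ω − cD U ψ) x κ) (η′ x κ)| ≤ √ℰ·√(2(M²)⁻¹·h² + 2·DG)`,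
   `DG = Σ nhsNormSq (covFd W η′ x κ κ)` (K6-face (P4) + `M²·√A·√(M^{d−1}(2M⁻¹h² + 2M·DG)) = M²·√(M^d A)·√(2M⁻²h² + 2DG)`).
K6c multiplies by 16, absorbs with `2ab ≤ δa² + δ⁻¹b²`, and displays the smallness of `DSum`, `S2sum`, `loopRad(r_k)`.
HONEST FRAMING.  Bookkeeping on OUR lattice objects at ONE unitary background in the tower's small-field class; nothing about Bałaban's
minimisers; (P♮)_W, (ML_w) at `W ≠ 1`, T-E_w and NE3 are NOT proved; spine PROVED 0∕9; finite T⁴ rung (B)+1 — NOT infinite volume, NOT mass gap,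
NOT BetaPertH, NOT Clay.  ABSOLUTE RULE kept: no printed sentence is a hypothesis (context only: [Balaban1985Averaging] (42)–(48), (120)–(125)).
PLACEMENT: `Summits/QuantumFields/BalabanUV/`; imports accepted modules only; moves nothing.  HONEST DEPENDENCY: continuum YM on T⁴ ⇐ BetaPertH
∧ nine spine estimates (0/9 proved); BetaPertH ⇐ (D1) ∧ (D4) ∧ CAP+tail; G-an2-4 gates asym, D1 and NE2/3/4.
-/

set_option autoImplicit false

open scoped BigOperators Matrix.Norms.L2Operator
open Finset

namespace Summit.QuantumFields.BalabanUV.T4Continuum.NE3SlicePoincareRemainderE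

open Literature.MathematicalPhysics.QuantumFieldTheory.Balaban1983to89
open B7Prop1Explicit B7Prop2Explicit MatrixNorms
open T4AveragingDeficitWall (IsUnitaryCfg IsSkewDir SmallField Ad)
open T4AveragingDeficitWallBoundary (IsPeriodicCfg periodBox)
open T4AveragingDeficitNonAbelian (Ad_sub)
open AveragingDeficitPeriodicCounting (IsPeriodicDir)
open AveragingDeficitHSInner (nhsNormSq_Ad)
open AveragingDeficitCovGrad (covFd)
open AveragingDeficitTwoLevelPrep (prop1Radius)
open AveragingDeficitMultiLevelPrep (cavgIter tower LevelSmall TangentIter cavgIter_unitary_small)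
open SpreadLift (loopRad)
open BlockAveragePushDirGauge (gaugeDir)
open NE3CovariantCalculus (hsR cD nhsNormSq_sub_le nhsNormSq_neg)
open NE3TangentCovariantTower (framePotW)
open NE3CovariantBlockMean (bmeanIterW)
open NE3CovariantLineSumsL2 (l2sq)
open NE3CovariantLineSumsTower (QstrIter ErrIter QstrIter_add)
open NE3CovariantLineSumsL2Tower (rho S2sum sqrt_l2sq_ErrIter_le rho_nonneg)
open NE3ExactLineSumsTower (DefIter DSum QstrIter_gaugeDir_eq DSum_nonneg)
open NE3ExactLineSumsL2 (l2sq_DefIter_le_of_levelSmall)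
open NE3CovariantLineAdjoint (JmpW TWc)
open NE3CombVsTowerEnd (sum_norm_TWc_sub_Ad_QstrIter_sq_le)
open NE3FrameFreeTangency (QstrIter_eq_neg_ErrIter_of_frameFree)
open NE3FrameFreeSliceW (frameFreeBlockLandauW)
open NE3CovariantFacePairings (abs_sum_hsR_JmpW_le_sqrt)

noncomputable section

variable {d : ℕ} {n : Type*} [Fintype n] [DecidableEq n]

/-! ## §1 The exact decomposition of the non-exact part -/

/-- `Ad_{U(z,κ)} (gaugeDir U ψ z κ) = −cD U κ ψ z` (START-framed covariant difference; ρ-g23-2). [folklore] -/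
theorem Ad_gaugeDir_eq_neg_cD (U : Site d → Fin d → (Matrix n n ℂ)ˣ) (ψ : Site d → Matrix n n ℂ) (z : Site d) (κ : Fin d) :
    Ad (U z κ) (gaugeDir U ψ z κ) = -cD U κ ψ z := by
  unfold gaugeDir cD
  rw [Ad_sub, ← T4AveragingDeficitNonAbelian.Ad_mul, mul_inv_cancel, AveragingDeficitNearIdentity.Ad_one]
  abel

/-- **(E) — THE NON-EXACT PART OF THE COMB LINE SUMS OF `η′` IS THREE NAMED SMALL TERMS.**  For `Y ∈ T_♮(W) = frameFreeBlockLandauW L N (k+1) W`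
in the tower's small-field class, written `Y = η′ + gaugeDir W ζ′`, with `U := cavgIter L (k+1) W`, `ψ := bmeanIterW L (k+1) W ζ′`:
`((L^d)⁻¹)^{k+1}•TWc η′ z κ − cD U κ ψ z = [((L^d)⁻¹)^{k+1}•TWc η′ z κ − Ad_{U(z,κ)} (QstrIter η′ z κ)] − Ad_{U(z,κ)} (ErrIter Y z κ) − Ad_{U(z,κ)} (DefIter ζ′ z κ)`
(K4-0 by name for the bracket; Φ5-TAN `QstrIter Y = −ErrIter Y`; K3 `QstrIter (gaugeDir W ζ′) = gaugeDir U ψ + DefIter ζ′`; linearity of `QstrIter`). [folklore] -/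
theorem nonexact_eq [Nonempty n] {L N : ℕ} [NeZero N] (hL : 1 ≤ L) (k : ℕ) {W : Site d → Fin d → (Matrix n n ℂ)ˣ} {x : ℝ}
    (hWu : IsUnitaryCfg W) (hWP : IsPeriodicCfg W ((tower L N (k + 1) : ℕ) : ℤ)) (hx : 0 ≤ x) (hs : LevelSmall d L k x)
    (hWx : SmallField W x) {Y : Site d → Fin d → Matrix n n ℂ} (hY : Y ∈ frameFreeBlockLandauW (d := d) (n := n) L N (k + 1) W)
    {η' : Site d → Fin d → Matrix n n ℂ} {ζ' : Site d → Matrix n n ℂ} (hYeq : ∀ (y : Site d) (κ : Fin d), Y y κ = η' y κ + gaugeDir W ζ' y κ)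
    (z : Site d) (κ : Fin d) :
    (((L : ℝ) ^ d)⁻¹) ^ (k + 1) • TWc L (k + 1) W η' z κ - cD (cavgIter L (k + 1) W) κ (bmeanIterW L (k + 1) W ζ') z
      = ((((L : ℝ) ^ d)⁻¹) ^ (k + 1) • TWc L (k + 1) W η' z κ - Ad (cavgIter L (k + 1) W z κ) (QstrIter L (k + 1) W η' z κ))
        - Ad (cavgIter L (k + 1) W z κ) (ErrIter L (k + 1) W Y z κ)
        - Ad (cavgIter L (k + 1) W z κ) (DefIter L (k + 1) W ζ' z κ) := by
  obtain ⟨hYs, hYP, hT, hF, -⟩ := hY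
  have hF' : framePotW L (k + 1) W Y = 0 := funext fun w => hF w
  have hT' : TangentIter L (k + 1 - 1) W Y := hT
  rw [Nat.add_sub_cancel] at hT'
  have hQY := QstrIter_eq_neg_ErrIter_of_frameFree (M := N) hL k hWu hWP hx hs hWx hYs hYP hT' hF'
  have hQζ := QstrIter_gaugeDir_eq L (k + 1) W ζ'
  -- `QstrIter Y = QstrIter η′ + QstrIter (gaugeDir W ζ′)` by exact additivity
  have hYfun : Y = fun y μ => η' y μ + gaugeDir W ζ' y μ := funext fun y => funext fun μ => hYeq y μ
  have hadd := QstrIter_add L (k + 1) W η' (gaugeDir W ζ')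
  rw [← hYfun] at hadd
  have hη : QstrIter L (k + 1) W η' z κ = QstrIter L (k + 1) W Y z κ - QstrIter L (k + 1) W (gaugeDir W ζ') z κ := by
    have h := congr_fun (congr_fun hadd z) κ
    rw [h]; abel
  have hQYz : QstrIter L (k + 1) W Y z κ = -ErrIter L (k + 1) W Y z κ := by
    exact congr_fun (congr_fun hQY z) κ
  have hQζz : QstrIter L (k + 1) W (gaugeDir W ζ') z κ
      = gaugeDir (cavgIter L (k + 1) W) (bmeanIterW L (k + 1) W ζ') z κ + DefIter L (k + 1) W ζ' z κ := by
    exact congr_fun (congr_fun hQζ z) κ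
  rw [hη, hQYz, hQζz, Ad_sub, AveragingDeficitNearIdentity.Ad_neg, AveragingDeficitNearIdentity.Ad_add, Ad_gaugeDir_eq_neg_cD]
  abel

/-! ## §2 The weighted energy of the non-exact part -/

/-- Three-term splitting in nhs with unitary transports dropped: `nhsNormSq (A − Ad u B − Ad u C) ≤ 4·nhsNormSq A + 4·nhsNormSq B + 2·nhsNormSq C`. [folklore] -/
theorem nhsNormSq_sub_Ad_sub_Ad_le {u : (Matrix n n ℂ)ˣ} (hu : u ∈ unitaryUnits (Matrix n n ℂ)) (A B C : Matrix n n ℂ) :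
    nhsNormSq (A - Ad u B - Ad u C) ≤ 4 * nhsNormSq A + 4 * nhsNormSq B + 2 * nhsNormSq C := by
  have h1 := nhsNormSq_sub_le (A - Ad u B) (Ad u C)
  have h2 := nhsNormSq_sub_le A (Ad u B)
  rw [nhsNormSq_Ad hu] at h1 h2
  linarith

/-- `Σ_y ‖f y‖² ≤ card n · Σ_y nhsNormSq (f y)` (site fields). [folklore] -/
theorem sum_norm_sq_le_card_mul (F : Finset (Site d)) (f : Site d → Matrix n n ℂ) :
    ∑ y ∈ F, ‖f y‖ ^ 2 ≤ (Fintype.card n : ℝ) * ∑ y ∈ F, nhsNormSq (f y) := by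
  rw [Finset.mul_sum]; exact Finset.sum_le_sum fun y _ => opNorm_sq_le_card_mul_nhsNormSq _

/-- `Σ_yΣ_κ ‖Y y κ‖² ≤ card n · Σ_yΣ_κ nhsNormSq (Y y κ)` (direction fields; `= l2sq`). [folklore] -/
theorem sum_sum_norm_sq_le_card_mul (F : Finset (Site d)) (Y : Site d → Fin d → Matrix n n ℂ) :
    ∑ y ∈ F, ∑ κ : Fin d, ‖Y y κ‖ ^ 2 ≤ (Fintype.card n : ℝ) * ∑ y ∈ F, ∑ κ : Fin d, nhsNormSq (Y y κ) := by
  rw [Finset.mul_sum]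
  refine Finset.sum_le_sum fun y _ => ?_
  rw [Finset.mul_sum]
  exact Finset.sum_le_sum fun κ _ => opNorm_sq_le_card_mul_nhsNormSq _

omit [Fintype n] [DecidableEq n] in
/-- The tower weight identity `M^d·(ρ^k)² = L^d·(L^k)²`, `M = L^{k+1}`, `ρ = √(L²∕L^d)` (`L ≥ 1`). [folklore] -/
theorem pow_mul_rho_pow_sq {L : ℕ} (hL : 1 ≤ L) (d k : ℕ) :
    ((L : ℝ) ^ (k + 1)) ^ d * (rho d L ^ k) ^ 2 = (L : ℝ) ^ d * ((L : ℝ) ^ k) ^ 2 := by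
  have hL0 : (0 : ℝ) < L := by exact_mod_cast (by omega : 0 < L)
  have hLd : (0 : ℝ) < (L : ℝ) ^ d := by positivity
  have hρ2 : rho d L ^ 2 = (L : ℝ) ^ 2 / (L : ℝ) ^ d := by
    unfold rho; rw [Real.sq_sqrt (by positivity)]
  have hρ2k : (rho d L ^ k) ^ 2 = ((L : ℝ) ^ 2 / (L : ℝ) ^ d) ^ k := by
    rw [← pow_mul, show k * 2 = 2 * k from Nat.mul_comm k 2, pow_mul, hρ2]
  rw [hρ2k, div_pow]
  field_simp
  ring

/-- **`ℰ ≤ …` — THE WEIGHTED ENERGY OF THE NON-EXACT PART** (tower class; `S2sum d L (k+1) x ≤ rho d L ∕ 2` is C1's class hypothesis):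
with `M = L^{k+1}`, `E z κ := ((L^d)⁻¹)^{k+1}•TWc η′ z κ − cD U κ ψ z`,
`M^d·Σ_{z∈periodBox N}Σ_κ nhsNormSq (E z κ) ≤ 4·(2(4d+5)∕10·DSum)²·M²·(card n·h²) + 16·S2sum²·L^d·(L^k)²·(card n·y²) + 2d·(20·loopRad(r_k))²·(card n·Σ nhsNormSq ζ′)`. [folklore] -/
theorem weightedEnergy_nonexact_le [Nonempty n] {L N : ℕ} (hL : 2 ≤ L) (hN : 1 ≤ N) (k : ℕ) {W : Site d → Fin d → (Matrix n n ℂ)ˣ} {x : ℝ}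
    (hWu : IsUnitaryCfg W) (hWP : IsPeriodicCfg W ((tower L N (k + 1) : ℕ) : ℤ)) (hx : 0 ≤ x) (hs : LevelSmall d L k x)
    (hWx : SmallField W x) (hS2 : S2sum d L (k + 1) x ≤ rho d L / 2)
    {Y : Site d → Fin d → Matrix n n ℂ} (hY : Y ∈ frameFreeBlockLandauW (d := d) (n := n) L N (k + 1) W)
    {η' : Site d → Fin d → Matrix n n ℂ} (hη'P : IsPeriodicDir η' ((tower L N (k + 1) : ℕ) : ℤ)) {ζ' : Site d → Matrix n n ℂ}
    (hζ'P : ∀ (y : Site d) (τ : Fin d), ζ' (y + ((tower L N (k + 1) : ℕ) : ℤ) • e τ) = ζ' y)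
    (hYeq : ∀ (y : Site d) (κ : Fin d), Y y κ = η' y κ + gaugeDir W ζ' y κ) :
    ((L : ℝ) ^ (k + 1)) ^ d * ∑ z ∈ periodBox (d := d) N, ∑ κ : Fin d,
        nhsNormSq ((((L : ℝ) ^ d)⁻¹) ^ (k + 1) • TWc L (k + 1) W η' z κ - cD (cavgIter L (k + 1) W) κ (bmeanIterW L (k + 1) W ζ') z)
      ≤ 4 * (2 * ((4 * d + 5) / 10 * DSum d L (k + 1) x)) ^ 2 * ((L : ℝ) ^ (k + 1)) ^ 2
            * ((Fintype.card n : ℝ) * ∑ y ∈ periodBox (d := d) (tower L N (k + 1)), ∑ κ : Fin d, nhsNormSq (η' y κ))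
        + 16 * S2sum d L (k + 1) x ^ 2 * ((L : ℝ) ^ d * ((L : ℝ) ^ k) ^ 2)
            * ((Fintype.card n : ℝ) * ∑ y ∈ periodBox (d := d) (tower L N (k + 1)), ∑ κ : Fin d, nhsNormSq (Y y κ))
        + 2 * ((d : ℝ) * (20 * loopRad d L ((prop1Radius d L)^[k] x)) ^ 2)
            * ((Fintype.card n : ℝ) * ∑ y ∈ periodBox (d := d) (tower L N (k + 1)), nhsNormSq (ζ' y)) := by
  haveI : NeZero N := ⟨by omega⟩
  have hL1 : 1 ≤ L := le_trans (by norm_num) hL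
  have hYP : IsPeriodicDir Y ((tower L N (k + 1) : ℕ) : ℤ) := hY.2.1
  set M : ℕ := L ^ (k + 1) with hMdef
  have htow : tower L N (k + 1) = L ^ (k + 1) * N := NE3CurvedProjectedLandau.tower_eq_pow_mul L N (k + 1)
  have hMR : (M : ℝ) = (L : ℝ) ^ (k + 1) := by rw [hMdef]; push_cast; ring
  have hU := (cavgIter_unitary_small (d := d) hL1 k hWu hx hs hWx).1
  -- pointwise decomposition and three-term split
  have hpt : ∀ (z : Site d) (κ : Fin d),
      nhsNormSq ((((L : ℝ) ^ d)⁻¹) ^ (k + 1) • TWc L (k + 1) W η' z κ - cD (cavgIter L (k + 1) W) κ (bmeanIterW L (k + 1) W ζ') z)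
        ≤ 4 * nhsNormSq ((((L : ℝ) ^ d)⁻¹) ^ (k + 1) • TWc L (k + 1) W η' z κ - Ad (cavgIter L (k + 1) W z κ) (QstrIter L (k + 1) W η' z κ))
          + 4 * nhsNormSq (ErrIter L (k + 1) W Y z κ) + 2 * nhsNormSq (DefIter L (k + 1) W ζ' z κ) := by
    intro z κ
    rw [nonexact_eq hL1 k hWu hWP hx hs hWx hY hYeq z κ]
    exact nhsNormSq_sub_Ad_sub_Ad_le (hU z κ) _ _ _
  -- (E3) K4-0 in ℓ²
  have hη'M : ∀ (y : Site d) (τ μ : Fin d), η' (y + ((L ^ (k + 1) * N : ℕ) : ℤ) • e τ) μ = η' y μ := by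
    intro y τ μ; rw [← htow]; exact hη'P y τ μ
  have hE3 := sum_norm_TWc_sub_Ad_QstrIter_sq_le hL hN k hWu hx hs hWx η' hη'M
  -- (E1) C1's ℓ² tower for `ErrIter Y`
  have hE1 := sqrt_l2sq_ErrIter_le (d := d) (n := n) hL1 hN k hWu hWP hx hs hWx hS2 hYP
  -- (E2) K3's ℓ² bound for `DefIter ζ′`
  have hE2 := l2sq_DefIter_le_of_levelSmall hL hN k hWu hWP hx hs hWx hζ'P
  -- square (E1): `l2sq ErrIter ≤ (2 S2sum ρ^k)² · l2sq Y`
  have hE1sq : l2sq (periodBox (d := d) N) (ErrIter L (k + 1) W Y)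
      ≤ (2 * S2sum d L (k + 1) x * rho d L ^ k) ^ 2 * l2sq (periodBox (d := d) (tower L N (k + 1))) Y := by
    have h0 : 0 ≤ l2sq (periodBox (d := d) N) (ErrIter L (k + 1) W Y) := by
      unfold l2sq; exact Finset.sum_nonneg fun _ _ => Finset.sum_nonneg fun _ _ => sq_nonneg _
    have h0' : 0 ≤ l2sq (periodBox (d := d) (tower L N (k + 1))) Y := by
      unfold l2sq; exact Finset.sum_nonneg fun _ _ => Finset.sum_nonneg fun _ _ => sq_nonneg _
    have hc : 0 ≤ 2 * S2sum d L (k + 1) x * rho d L ^ k := by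
      have := NE3CovariantLineSumsL2Tower.S2sum_nonneg d L (k + 1) hx
      have := rho_nonneg d L
      positivity
    calc l2sq (periodBox (d := d) N) (ErrIter L (k + 1) W Y)
        = Real.sqrt (l2sq (periodBox (d := d) N) (ErrIter L (k + 1) W Y)) ^ 2 := (Real.sq_sqrt h0).symm
      _ ≤ (2 * S2sum d L (k + 1) x * rho d L ^ k * Real.sqrt (l2sq (periodBox (d := d) (tower L N (k + 1))) Y)) ^ 2 :=
          pow_le_pow_left₀ (Real.sqrt_nonneg _) hE1 2
      _ = (2 * S2sum d L (k + 1) x * rho d L ^ k) ^ 2 * l2sq (periodBox (d := d) (tower L N (k + 1))) Y := by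
          rw [mul_pow, Real.sq_sqrt h0']
  -- op → nhs conversions of the three inputs' right-hand sides
  have hconvη := sum_sum_norm_sq_le_card_mul (n := n) (periodBox (d := d) (L ^ (k + 1) * N)) η'
  have hconvY := sum_sum_norm_sq_le_card_mul (n := n) (periodBox (d := d) (tower L N (k + 1))) Y
  have hconvζ := sum_norm_sq_le_card_mul (n := n) (periodBox (d := d) (tower L N (k + 1))) ζ'
  -- nhs ≤ op on the three left-hand sides
  have hle1 : ∑ z ∈ periodBox (d := d) N, ∑ κ : Fin d,
      nhsNormSq ((((L : ℝ) ^ d)⁻¹) ^ (k + 1) • TWc L (k + 1) W η' z κ - Ad (cavgIter L (k + 1) W z κ) (QstrIter L (k + 1) W η' z κ))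
      ≤ ∑ z ∈ periodBox (d := d) N, ∑ κ : Fin d,
      ‖(((L : ℝ) ^ d)⁻¹) ^ (k + 1) • TWc L (k + 1) W η' z κ - Ad (cavgIter L (k + 1) W z κ) (QstrIter L (k + 1) W η' z κ)‖ ^ 2 :=
    Finset.sum_le_sum fun z _ => Finset.sum_le_sum fun κ _ => nhsNormSq_le_opNorm_sq _
  have hle2 : ∑ z ∈ periodBox (d := d) N, ∑ κ : Fin d, nhsNormSq (ErrIter L (k + 1) W Y z κ)
      ≤ l2sq (periodBox (d := d) N) (ErrIter L (k + 1) W Y) := by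
    unfold l2sq; exact Finset.sum_le_sum fun z _ => Finset.sum_le_sum fun κ _ => nhsNormSq_le_opNorm_sq _
  have hle3 : ∑ z ∈ periodBox (d := d) N, ∑ κ : Fin d, nhsNormSq (DefIter L (k + 1) W ζ' z κ)
      ≤ l2sq (periodBox (d := d) N) (DefIter L (k + 1) W ζ') := by
    unfold l2sq; exact Finset.sum_le_sum fun z _ => Finset.sum_le_sum fun κ _ => nhsNormSq_le_opNorm_sq _
  -- the weights
  have hL0 : (0 : ℝ) < L := by exact_mod_cast (by omega : 0 < L)
  have hXd : (((L : ℝ) ^ d)⁻¹) ^ (k + 1) = (((L : ℝ) ^ (k + 1)) ^ d)⁻¹ := by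
    rw [inv_pow, ← pow_mul, ← pow_mul, Nat.mul_comm d (k + 1)]
  have hX0 : ((L : ℝ) ^ (k + 1)) ^ d ≠ 0 := by positivity
  have hw1 : ((L : ℝ) ^ (k + 1)) ^ d * (((L : ℝ) ^ (k + 1)) ^ 2 * (((L : ℝ) ^ d)⁻¹) ^ (k + 1)) = ((L : ℝ) ^ (k + 1)) ^ 2 := by
    rw [hXd, mul_comm (((L : ℝ) ^ (k + 1)) ^ 2), ← mul_assoc, mul_inv_cancel₀ hX0, one_mul]
  have hw2 : ((L : ℝ) ^ (k + 1)) ^ d * (rho d L ^ k) ^ 2 = (L : ℝ) ^ d * ((L : ℝ) ^ k) ^ 2 := pow_mul_rho_pow_sq hL1 d k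
  have hw3 : ((L : ℝ) ^ (k + 1)) ^ d * (((L : ℝ) ^ d)⁻¹) ^ (k + 1) = 1 := by
    rw [hXd, mul_inv_cancel₀ hX0]
  -- assemble
  have hMd : (0 : ℝ) ≤ ((L : ℝ) ^ (k + 1)) ^ d := by positivity
  have hDS : 0 ≤ (2 * ((4 * d + 5) / 10 * DSum d L (k + 1) x)) ^ 2 := sq_nonneg _
  have hS2c : 0 ≤ (2 * S2sum d L (k + 1) x * rho d L ^ k) ^ 2 := sq_nonneg _
  set S1 := ∑ z ∈ periodBox (d := d) N, ∑ κ : Fin d,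
      nhsNormSq ((((L : ℝ) ^ d)⁻¹) ^ (k + 1) • TWc L (k + 1) W η' z κ - Ad (cavgIter L (k + 1) W z κ) (QstrIter L (k + 1) W η' z κ)) with hS1
  set S2 := ∑ z ∈ periodBox (d := d) N, ∑ κ : Fin d, nhsNormSq (ErrIter L (k + 1) W Y z κ) with hS2d
  set S3 := ∑ z ∈ periodBox (d := d) N, ∑ κ : Fin d, nhsNormSq (DefIter L (k + 1) W ζ' z κ) with hS3
  have hsplit : ∑ z ∈ periodBox (d := d) N, ∑ κ : Fin d,
        nhsNormSq ((((L : ℝ) ^ d)⁻¹) ^ (k + 1) • TWc L (k + 1) W η' z κ - cD (cavgIter L (k + 1) W) κ (bmeanIterW L (k + 1) W ζ') z)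
      ≤ 4 * S1 + 4 * S2 + 2 * S3 := by
    calc _ ≤ ∑ z ∈ periodBox (d := d) N, ∑ κ : Fin d,
          (4 * nhsNormSq ((((L : ℝ) ^ d)⁻¹) ^ (k + 1) • TWc L (k + 1) W η' z κ - Ad (cavgIter L (k + 1) W z κ) (QstrIter L (k + 1) W η' z κ))
            + 4 * nhsNormSq (ErrIter L (k + 1) W Y z κ) + 2 * nhsNormSq (DefIter L (k + 1) W ζ' z κ)) :=
          Finset.sum_le_sum fun z _ => Finset.sum_le_sum fun κ _ => hpt z κ
      _ = 4 * S1 + 4 * S2 + 2 * S3 := by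
          simp only [Finset.sum_add_distrib, ← Finset.mul_sum, hS1, hS2d, hS3]
  rw [htow] at hconvY hconvζ hE1sq hE2
  -- the three weighted pieces
  have hA : ((L : ℝ) ^ (k + 1)) ^ d * S1
      ≤ (2 * ((4 * d + 5) / 10 * DSum d L (k + 1) x)) ^ 2 * ((L : ℝ) ^ (k + 1)) ^ 2
          * ((Fintype.card n : ℝ) * ∑ y ∈ periodBox (d := d) (L ^ (k + 1) * N), ∑ κ : Fin d, nhsNormSq (η' y κ)) := by
    have h1 := (hle1.trans hE3).trans (mul_le_mul_of_nonneg_left hconvη (mul_nonneg hDS (by positivity)))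
    have h2 := mul_le_mul_of_nonneg_left h1 hMd
    calc ((L : ℝ) ^ (k + 1)) ^ d * S1
        ≤ ((L : ℝ) ^ (k + 1)) ^ d * ((2 * ((4 * d + 5) / 10 * DSum d L (k + 1) x)) ^ 2
          * (((L : ℝ) ^ (k + 1)) ^ 2 * (((L : ℝ) ^ d)⁻¹) ^ (k + 1))
          * ((Fintype.card n : ℝ) * ∑ y ∈ periodBox (d := d) (L ^ (k + 1) * N), ∑ κ : Fin d, nhsNormSq (η' y κ))) := h2
      _ = (2 * ((4 * d + 5) / 10 * DSum d L (k + 1) x)) ^ 2 * (((L : ℝ) ^ (k + 1)) ^ d * (((L : ℝ) ^ (k + 1)) ^ 2 * (((L : ℝ) ^ d)⁻¹) ^ (k + 1)))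
          * ((Fintype.card n : ℝ) * ∑ y ∈ periodBox (d := d) (L ^ (k + 1) * N), ∑ κ : Fin d, nhsNormSq (η' y κ)) := by ring
      _ = _ := by rw [hw1]
  have hB : ((L : ℝ) ^ (k + 1)) ^ d * S2
      ≤ 4 * S2sum d L (k + 1) x ^ 2 * ((L : ℝ) ^ d * ((L : ℝ) ^ k) ^ 2)
          * ((Fintype.card n : ℝ) * ∑ y ∈ periodBox (d := d) (L ^ (k + 1) * N), ∑ κ : Fin d, nhsNormSq (Y y κ)) := by
    have h1 : S2 ≤ (2 * S2sum d L (k + 1) x * rho d L ^ k) ^ 2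
          * ((Fintype.card n : ℝ) * ∑ y ∈ periodBox (d := d) (L ^ (k + 1) * N), ∑ κ : Fin d, nhsNormSq (Y y κ)) := by
      refine (hle2.trans hE1sq).trans (mul_le_mul_of_nonneg_left ?_ hS2c)
      unfold l2sq; exact hconvY
    have h2 := mul_le_mul_of_nonneg_left h1 hMd
    calc ((L : ℝ) ^ (k + 1)) ^ d * S2
        ≤ ((L : ℝ) ^ (k + 1)) ^ d * ((2 * S2sum d L (k + 1) x * rho d L ^ k) ^ 2
          * ((Fintype.card n : ℝ) * ∑ y ∈ periodBox (d := d) (L ^ (k + 1) * N), ∑ κ : Fin d, nhsNormSq (Y y κ))) := h2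
      _ = 4 * S2sum d L (k + 1) x ^ 2 * (((L : ℝ) ^ (k + 1)) ^ d * (rho d L ^ k) ^ 2)
          * ((Fintype.card n : ℝ) * ∑ y ∈ periodBox (d := d) (L ^ (k + 1) * N), ∑ κ : Fin d, nhsNormSq (Y y κ)) := by ring
      _ = _ := by rw [hw2]
  have hC : ((L : ℝ) ^ (k + 1)) ^ d * S3
      ≤ ((d : ℝ) * (20 * loopRad d L ((prop1Radius d L)^[k] x)) ^ 2)
          * ((Fintype.card n : ℝ) * ∑ y ∈ periodBox (d := d) (L ^ (k + 1) * N), nhsNormSq (ζ' y)) := by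
    have h1 : S3 ≤ (d : ℝ) * (20 * loopRad d L ((prop1Radius d L)^[k] x)) ^ 2 * (((L : ℝ) ^ d)⁻¹) ^ (k + 1)
          * ((Fintype.card n : ℝ) * ∑ y ∈ periodBox (d := d) (L ^ (k + 1) * N), nhsNormSq (ζ' y)) :=
      (hle3.trans hE2).trans (mul_le_mul_of_nonneg_left hconvζ (by positivity))
    have h2 := mul_le_mul_of_nonneg_left h1 hMd
    calc ((L : ℝ) ^ (k + 1)) ^ d * S3
        ≤ ((L : ℝ) ^ (k + 1)) ^ d * ((d : ℝ) * (20 * loopRad d L ((prop1Radius d L)^[k] x)) ^ 2 * (((L : ℝ) ^ d)⁻¹) ^ (k + 1)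
          * ((Fintype.card n : ℝ) * ∑ y ∈ periodBox (d := d) (L ^ (k + 1) * N), nhsNormSq (ζ' y))) := h2
      _ = ((d : ℝ) * (20 * loopRad d L ((prop1Radius d L)^[k] x)) ^ 2) * (((L : ℝ) ^ (k + 1)) ^ d * (((L : ℝ) ^ d)⁻¹) ^ (k + 1))
          * ((Fintype.card n : ℝ) * ∑ y ∈ periodBox (d := d) (L ^ (k + 1) * N), nhsNormSq (ζ' y)) := by ring
      _ = _ := by rw [hw3, mul_one]
  have hmain := mul_le_mul_of_nonneg_left hsplit hMd
  have hexp : ((L : ℝ) ^ (k + 1)) ^ d * (4 * S1 + 4 * S2 + 2 * S3)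
      = 4 * (((L : ℝ) ^ (k + 1)) ^ d * S1) + 4 * (((L : ℝ) ^ (k + 1)) ^ d * S2) + 2 * (((L : ℝ) ^ (k + 1)) ^ d * S3) := by ring
  rw [hexp] at hmain
  rw [htow]
  linarith [hA, hB, hC]

/-! ## §3 The `R_E` pairing -/

/-- **THE `R_E` PAIRING** (blueprint ρ-g23-3 §2(c); leaf-03-g8's (P4) with the weight moved onto `E`): for `M, N ≥ 1`, unitary `W`, ANY `E`, `η`,
`(M²)⁻¹·|Σ_xΣ_κ hsR (JmpW M W E x κ) (η x κ)| ≤ √(M^d·Σ_zΣ_κ nhsNormSq (E z κ))·√(2(M²)⁻¹·ΣΣ nhsNormSq η + 2·ΣΣ_κ nhsNormSq (covFd W η · κ κ))`. [folklore] -/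
theorem abs_RE_le [Nonempty n] (hd : 1 ≤ d) {M : ℕ} (hM : 1 ≤ M) (N : ℕ) {W : Site d → Fin d → (Matrix n n ℂ)ˣ}
    (hW : IsUnitaryCfg W) (E η : Site d → Fin d → Matrix n n ℂ) :
    ((M : ℝ) ^ 2)⁻¹ * |∑ x ∈ periodBox (d := d) (M * N), ∑ κ : Fin d, hsR (JmpW M W E x κ) (η x κ)|
      ≤ Real.sqrt ((M : ℝ) ^ d * ∑ z ∈ periodBox (d := d) N, ∑ κ : Fin d, nhsNormSq (E z κ))
        * Real.sqrt (2 * ((M : ℝ) ^ 2)⁻¹ * ∑ x ∈ periodBox (d := d) (M * N), ∑ κ : Fin d, nhsNormSq (η x κ)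
            + 2 * ∑ x ∈ periodBox (d := d) (M * N), ∑ κ : Fin d, nhsNormSq (covFd W η x κ κ)) := by
  have h := abs_sum_hsR_JmpW_le_sqrt hM N hW E η
  have hM0 : (0 : ℝ) < M := by exact_mod_cast (by omega : 0 < M)
  set A := ∑ z ∈ periodBox (d := d) N, ∑ κ : Fin d, nhsNormSq (E z κ) with hA
  set Hn := ∑ x ∈ periodBox (d := d) (M * N), ∑ κ : Fin d, nhsNormSq (η x κ) with hHn
  set Dg := ∑ x ∈ periodBox (d := d) (M * N), ∑ κ : Fin d, nhsNormSq (covFd W η x κ κ) with hDg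
  have hA0 : 0 ≤ A := Finset.sum_nonneg fun _ _ => Finset.sum_nonneg fun _ _ => nhsNormSq_nonneg _
  have hHn0 : 0 ≤ Hn := Finset.sum_nonneg fun _ _ => Finset.sum_nonneg fun _ _ => nhsNormSq_nonneg _
  have hDg0 : 0 ≤ Dg := Finset.sum_nonneg fun _ _ => Finset.sum_nonneg fun _ _ => nhsNormSq_nonneg _
  -- the face factor carries the weight: `M^{d−1}(2∕M·Hn + 2M·Dg) = M^d·(2M⁻²·Hn + 2·Dg)` (`d ≥ 1`)
  have hface : (M : ℝ) ^ (d - 1) * (2 / (M : ℝ) * Hn + 2 * (M : ℝ) * Dg) = (M : ℝ) ^ d * (2 * ((M : ℝ) ^ 2)⁻¹ * Hn + 2 * Dg) := by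
    have hpow : (M : ℝ) ^ d = (M : ℝ) ^ (d - 1) * M := by rw [← pow_succ, Nat.sub_add_cancel hd]
    rw [hpow]
    field_simp
  set X := 2 * ((M : ℝ) ^ 2)⁻¹ * Hn + 2 * Dg with hX
  have e1 : Real.sqrt A * Real.sqrt ((M : ℝ) ^ (d - 1) * (2 / (M : ℝ) * Hn + 2 * (M : ℝ) * Dg))
      = Real.sqrt (A * ((M : ℝ) ^ (d - 1) * (2 / (M : ℝ) * Hn + 2 * (M : ℝ) * Dg))) := (Real.sqrt_mul hA0 _).symm
  have e2 : Real.sqrt ((M : ℝ) ^ d * A) * Real.sqrt X = Real.sqrt ((M : ℝ) ^ d * A * X) := (Real.sqrt_mul (by positivity) X).symm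
  have e3 : A * ((M : ℝ) ^ (d - 1) * (2 / (M : ℝ) * Hn + 2 * (M : ℝ) * Dg)) = (M : ℝ) ^ d * A * X := by rw [hface]; ring
  have key : (M : ℝ) ^ 2 * (Real.sqrt A * Real.sqrt ((M : ℝ) ^ (d - 1) * (2 / (M : ℝ) * Hn + 2 * (M : ℝ) * Dg)))
      = (M : ℝ) ^ 2 * (Real.sqrt ((M : ℝ) ^ d * A) * Real.sqrt X) := by rw [e1, e3, ← e2]
  rw [key] at h
  have hM2 : (0 : ℝ) < (M : ℝ) ^ 2 := by positivity
  rw [inv_mul_le_iff₀ hM2]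
  exact h

end

end Summit.QuantumFields.BalabanUV.T4Continuum.NE3SlicePoincareRemainderE
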